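import Literature.NumberTheory.PAdicHodge.BmaxPlusTransportedPeriodHom
import HarnessLib

/-!
# The transported period maps in `B_dR⁺`: honest `P⁰ = f∘LT`, `Q⁰ = f∘φ∘LT : T_pŴ_D →+ B_dR⁺(F)`, their integrating pair along a Kummer tower,
# (K₂) for the transported resolution, and `Γ_F`-invariant recombinations (the Hodge pair `A·P⁰ + B·Q⁰`, `C·P⁰`)

Topic `Literature/NumberTheory/PAdicHodge` (theorems only; no definition, no named fact, no instance, no `sorry`). Sequel of
`BmaxPlusTransportedPeriodHom` (the honest transported `A_max`-period map `LT : T_pŴ_D →+ A_max`, `LT τ = Λ_N(ι[T(τ)~], z)`, `ℤ_p`-linear,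
`Γ_F`-equivariant, Honda relation, Kummer identity `LT(κ_u σ) = σΛ_{Tu} − Λ_{Tu}`) — the ramified-cell twin of `BmaxPlusPhiRoadPeriodHoms` /
`BmaxPlusPhiRoadKummer` (there: `W/ℤ`, torsion towers). With `f = bmaxPlusToBdR : A_max → B_dR⁺` (honest comparison, `BmaxPlusToBdR`):

* §1 ★★ `exists_transported_periodHoms` — HONEST additive **`P⁰ := f∘LT`, `Q⁰ := f∘φ∘LT : T_pŴ_D →+ B_dR⁺(F)`**, `ℤ_p`-linear
  (`P(c • τ) = ι(c)·P τ`) and `Γ_F`-equivariant (`σ(P τ) = P(σ • τ)`), together with `LT` and its specification.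
* §2 ★★ `transported_integrating_pair` — for a `[p]_{W_D}`-division tower `u` of an `F`-rational point (`Γ_F`-fixed `u₀`, `‖u₀‖^N ≤ ‖p‖`) with
  transport `Tu` and `b⁰_ω := f Λ_{Tu}`, `b⁰_η := f φΛ_{Tu}`: **`P⁰(κ_u σ) = σ·b⁰_ω − b⁰_ω`, `Q⁰(κ_u σ) = σ·b⁰_η − b⁰_η`** (hypotheses `hbω`, `hbη`
  of the socket's capstone).
* §3 ★★ `isTeichLog_transported_resolution` — **(K₂) in `c_L`-free form** for the transported pair: for every `τ`, `k ≥ 1` and every `Λ ∈ A_max`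
  with the Honda relation (e.g. `Λ_{Tu}`), `IsTeichLog k (p^M·(Q⁰ τ·fΛ − P⁰ τ·f φΛ))` for some `M` (`isTeichLog_pow_mul_bmaxPlusToBdR_det_of_honda`:
  the Legendre determinant of two Honda solutions lies in `(A_max)^{φ=p}`, whose image mod `Fil^k` is `ℚ_p ⊗ X⁰_k` — NO `θ = 0` needed).
* §4 `exists_recombined_periodHoms` — for `Γ_F`-INVARIANT scalars `A, B, C ∈ B_dR⁺` commuting with the `ℚ_p`-scalars (e.g. images of elements of
  `F`): the recombined maps **`Pω″ = A·P⁰ + B·Q⁰`, `Pη″ = C·P⁰`** are again additive, `ℤ_p`-linear, `Γ_F`-equivariant, with integrating pair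
  `b″_ω = A·b⁰_ω + B·b⁰_η`, `b″_η = C·b⁰_ω`, and resolution **`Pη″ τ·b″_ω − Pω″ τ·b″_η = −(B·C)·(Q⁰ τ·b⁰_ω − P⁰ τ·b⁰_η)`** (so for `C = B⁻¹` the
  transported (K₂) transfers by `IsTeichLog.neg`).

Purpose (line `kato_lever`, crux K★ `stmt-BirchSwinnertonDyer-22226`, memo `Lines/kato-lever-K2-ramified-cm-transport.md` §8–§9, T2/T5): with the
transported Hodge line `log_{W_D} ≡ A·log_{E₀} + B·log_{E₀}(Xᵖ)` (`TransportedHodgeLine`) the cells' period pair is `(Pω″, Pη″) = (A·P⁰ + B·Q⁰, B⁻¹·P⁰)`;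
what this file does NOT supply is analytic: `Pω″ ⊂ Fil¹` and `θ(b″_ω) = p^N·log_{W_D}(u₀)` ((HL-eval), the LEAD's J-series), and non-degeneracy.
Infrastructure only: BSD / K★ are NOT proved by any of this; nothing about elliptic curves over number fields is proved here.

## References
* P. Colmez, *Périodes p-adiques des variétés abéliennes*, Math. Ann. 292 (1992), §2. [Colmez1992PeriodesAbeliennes]
* J.-M. Fontaine, *Le corps des périodes p-adiques*, Astérisque 223 (1994), Exp. II §1.5, Exp. III Th. 5.3.7. [FontaineAsterisque223III]
* S. Bloch, K. Kato, *L-functions and Tamagawa numbers of motives* (1990), Ex. 3.10.1. [BlochKato1990]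
* K. Kato, LNM 1553 (1993), Ch. II §1.4, Lemma 1.4.3. [Kato1993LNM1553]
-/

noncomputable section

open Ideal WittVector ValuativeRel Field
open scoped Classical

namespace Literature.NumberTheory.PAdicHodge

open Literature.NumberTheory.GaloisRepresentations Literature.NumberTheory.GaloisRepresentations.IsNonarchimedeanLocalField
open Literature.NumberTheory.GaloisRepresentations.LubinTate Literature.NumberTheory.EllipticCurves
open Literature.RingTheory.FormalGroups GaloisContinuity

variable {F : Type} [Field F] [ValuativeRel F] [TopologicalSpace F] [IsNonarchimedeanLocalField F] [CharZero F]
  {p : ℕ} [hpp : Fact p.Prime] [Fact (¬ IsUnit (p : integerC F))] [IsAdicComplete (Ideal.span {(p : integerC F)}) (integerC F)]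
  {hp : valuation F p < 1} (D : EisensteinRoot F p hp) {hθ : Function.Surjective (fontaineTheta (integerC F) p)}
  (W : WeierstrassCurve (EisensteinRoot.CoeffDisc D)) (E₀ : WeierstrassCurve ℤ)
  (hWE : W.map (Ideal.Quotient.mk (Ideal.span {EisensteinRoot.CoeffDisc.of D (AdjoinRoot.root D.poly)})) =
    (E₀.map (algebraMap ℤ (EisensteinRoot.CoeffDisc D))).map
      (Ideal.Quotient.mk (Ideal.span {EisensteinRoot.CoeffDisc.of D (AdjoinRoot.root D.poly)})))
  (ψ : EisensteinRoot.CoeffDisc D →+* LTCoeff F) (hψ : ∀ c, algebraMap (LTCoeff F) F (ψ c) = EisensteinRoot.CoeffDisc.toF D c)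

/-! ## §1 The honest transported period maps `P⁰ = f∘LT`, `Q⁰ = f∘φ∘LT` -/

include hWE hψ in
set_option maxHeartbeats 3200000 in
/-- ★★ **The honest transported period maps.** For `N ≥ e` there are an additive `LT : T_pŴ_D →+ A_max` with `LT τ = Λ_N(ι[T(τ)~], z)` for every
transport and every witness, and additive `P⁰, Q⁰ : T_pŴ_D →+ B_dR⁺(F)` with `P⁰ = bmaxPlusToBdR ∘ LT`, `Q⁰ = bmaxPlusToBdR ∘ φ ∘ LT`, both
`ℤ_p`-linear (`P(c • τ) = ι(c)·P τ`) and `Γ_F`-equivariant (`σ(P τ) = P(σ • τ)`; `bmaxPlusToBdR` is equivariant and `φσ = σφ`).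
[cite: Colmez1992PeriodesAbeliennes, §2] [cite: FontaineAsterisque223III, Exp. II §1.5] -/
theorem exists_transported_periodHoms {N : ℕ} (hN : D.e ≤ N) :
    ∃ (LT : AinfTop.TatePtO F (W.map ψ) p →+ BmaxPlus F p) (P₀ Q₀ : AinfTop.TatePtO F (W.map ψ) p →+ BdRPlusTop F p),
      (∀ (τ : AinfTop.TatePtO F (W.map ψ) p) (w : ℕ → (maxNilIdealC F).toIdeal) (hw : ∀ n, AinfTop.mulPC F p E₀ (w (n + 1)) = w n)
        (_ : ∀ n, ‖(((w n : (maxNilIdealC F).toIdeal) : CBall F) : CompletedAlgClosure F) -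
      (((AinfTop.seqO (W.map ψ) τ n : (maxNilIdealC F).toIdeal) : CBall F) : CompletedAlgClosure F)‖ ≤ ‖((D.rootC : integerC F) : CompletedAlgClosure F)‖)
        (z : bmaxZero F p), algebraMap (Ainf (p := p) F) (bmaxZero F p)
        ((AinfTop.of F p).symm (((AinfTop.divisionLiftPt E₀ hθ w hw).val : (AinfTop.nilTheta F p hθ).toIdeal) : AinfTop F p)) ^ N =
      (p : bmaxZero F p) * z →
        LT τ = PadicLogSeries.logSum ((algebraMap (Ainf (p := p) F) (bmaxZero F p)).comp zpToAinf) (GaloisContinuity.formalLogNum E₀ p) N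
          (algebraMap (Ainf (p := p) F) (bmaxZero F p)
            ((AinfTop.of F p).symm (((AinfTop.divisionLiftPt E₀ hθ w hw).val : (AinfTop.nilTheta F p hθ).toIdeal) : AinfTop F p))) z) ∧
      (∀ τ, P₀ τ = BdRPlusTop.of F p (bmaxPlusToBdR F p (LT τ))) ∧
      (∀ τ, Q₀ τ = BdRPlusTop.of F p (bmaxPlusToBdR F p (frobBmaxPlus F p (LT τ)))) ∧
      (∀ (c : ℤ_[p]) (τ : AinfTop.TatePtO F (W.map ψ) p), P₀ (c • τ) = BdRPlusTop.of F p (qpToBdR (c : ℚ_[p])) * P₀ τ) ∧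
      (∀ (c : ℤ_[p]) (τ : AinfTop.TatePtO F (W.map ψ) p), Q₀ (c • τ) = BdRPlusTop.of F p (qpToBdR (c : ℚ_[p])) * Q₀ τ) ∧
      (∀ (σ : absoluteGaloisGroup F) (τ : AinfTop.TatePtO F (W.map ψ) p), BdRPlusTop.gal F p σ (P₀ τ) = P₀ (σ • τ)) ∧
      (∀ (σ : absoluteGaloisGroup F) (τ : AinfTop.TatePtO F (W.map ψ) p), BdRPlusTop.gal F p σ (Q₀ τ) = Q₀ (σ • τ)) := by
  obtain ⟨LT, hLT, hsmul, hgal⟩ := exists_addMonoidHom_logSum_transport D W E₀ hWE ψ hψ (hθ := hθ) hN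
  let f : BmaxPlus F p →+* BdRPlusTop F p := (BdRPlusTop.of F p).toRingHom.comp (bmaxPlusToBdR F p)
  let P₀ : AinfTop.TatePtO F (W.map ψ) p →+ BdRPlusTop F p := f.toAddMonoidHom.comp LT
  let Q₀ : AinfTop.TatePtO F (W.map ψ) p →+ BdRPlusTop F p := (f.comp (frobBmaxPlus F p)).toAddMonoidHom.comp LT
  have hfc : ∀ c : ℤ_[p], f (ainfToBmaxPlus F p (zpToAinf c)) = BdRPlusTop.of F p (qpToBdR (c : ℚ_[p])) := fun c => by
    change BdRPlusTop.of F p (bmaxPlusToBdR F p (ainfToBmaxPlus F p (zpToAinf c))) = _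
    rw [bmaxPlusToBdR_ainfToBmaxPlus_zpToAinf]
  have hφc : ∀ c : ℤ_[p], frobBmaxPlus F p (ainfToBmaxPlus F p (zpToAinf c)) = ainfToBmaxPlus F p (zpToAinf c) := fun c => by
    rw [frobBmaxPlus_ainfToBmaxPlus, frobenius_zpToAinf]
  refine ⟨LT, P₀, Q₀, hLT, fun τ => rfl, fun τ => rfl, ?_, ?_, ?_, ?_⟩
  · intro c τ
    change f (LT (c • τ)) = _ * f (LT τ)
    rw [hsmul, map_mul, hfc]
  · intro c τ
    change f (frobBmaxPlus F p (LT (c • τ))) = _ * f (frobBmaxPlus F p (LT τ))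
    rw [hsmul, map_mul, hφc, map_mul, hfc]
  · intro σ τ
    change BdRPlusTop.gal F p σ (BdRPlusTop.of F p (bmaxPlusToBdR F p (LT τ))) = BdRPlusTop.of F p (bmaxPlusToBdR F p (LT (σ • τ)))
    rw [BdRPlusTop.gal_of, galBdRPlus_bmaxPlusToBdR, hgal]
  · intro σ τ
    change BdRPlusTop.gal F p σ (BdRPlusTop.of F p (bmaxPlusToBdR F p (frobBmaxPlus F p (LT τ)))) =
      BdRPlusTop.of F p (bmaxPlusToBdR F p (frobBmaxPlus F p (LT (σ • τ))))
    rw [BdRPlusTop.gal_of, galBdRPlus_bmaxPlusToBdR, galBmaxPlus_frobBmaxPlus, hgal]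

/-! ## §2 The transported integrating pair along a Kummer tower -/

include hWE in
set_option maxHeartbeats 3200000 in
/-- ★★ **The transported integrating pair.** With `P⁰, Q⁰` recognised through `hLT`, `hP₀`, `hQ₀`, a `[p]_{W_D}`-division tower `u` of a `Γ_F`-fixed point
(`‖u₀‖^N ≤ ‖p‖`, `N ≥ e`) with transport `Tu`, `Λ_{Tu} = Λ_N(ι[Tu~], z)`, `b⁰_ω := bmaxPlusToBdR Λ_{Tu}`, `b⁰_η := bmaxPlusToBdR (φΛ_{Tu})`: for every
`σ ∈ Γ_F`, **`P⁰(κ_u σ) = σ·b⁰_ω − b⁰_ω`** and **`Q⁰(κ_u σ) = σ·b⁰_η − b⁰_η`** (`logSum_transport_kummerCocycleO`; `bmaxPlusToBdR` is `Γ_F`-equivariant,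
`φσ = σφ`). [cite: BlochKato1990, Ex. 3.10.1] [cite: Kato1993LNM1553, Ch. II Lemma 1.4.3] [cite: FontaineAsterisque223III, Exp. II §1.5] -/
theorem transported_integrating_pair {N : ℕ} (hN : D.e ≤ N)
    {LT : AinfTop.TatePtO F (W.map ψ) p →+ BmaxPlus F p} {P₀ Q₀ : AinfTop.TatePtO F (W.map ψ) p →+ BdRPlusTop F p}
    (hLT : ∀ (τ : AinfTop.TatePtO F (W.map ψ) p) (w : ℕ → (maxNilIdealC F).toIdeal) (hw : ∀ n, AinfTop.mulPC F p E₀ (w (n + 1)) = w n)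
        (_ : ∀ n, ‖(((w n : (maxNilIdealC F).toIdeal) : CBall F) : CompletedAlgClosure F) -
      (((AinfTop.seqO (W.map ψ) τ n : (maxNilIdealC F).toIdeal) : CBall F) : CompletedAlgClosure F)‖ ≤ ‖((D.rootC : integerC F) : CompletedAlgClosure F)‖)
        (z : bmaxZero F p), algebraMap (Ainf (p := p) F) (bmaxZero F p)
        ((AinfTop.of F p).symm (((AinfTop.divisionLiftPt E₀ hθ w hw).val : (AinfTop.nilTheta F p hθ).toIdeal) : AinfTop F p)) ^ N =
      (p : bmaxZero F p) * z →
        LT τ = PadicLogSeries.logSum ((algebraMap (Ainf (p := p) F) (bmaxZero F p)).comp zpToAinf) (GaloisContinuity.formalLogNum E₀ p) N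
          (algebraMap (Ainf (p := p) F) (bmaxZero F p)
            ((AinfTop.of F p).symm (((AinfTop.divisionLiftPt E₀ hθ w hw).val : (AinfTop.nilTheta F p hθ).toIdeal) : AinfTop F p))) z)
    (hP₀ : ∀ τ, P₀ τ = BdRPlusTop.of F p (bmaxPlusToBdR F p (LT τ)))
    (hQ₀ : ∀ τ, Q₀ τ = BdRPlusTop.of F p (bmaxPlusToBdR F p (frobBmaxPlus F p (LT τ))))
    {u : ℕ → (maxNilIdealC F).toIdeal} (hup : ∀ n, AinfRamTop.mulPC W (u (n + 1)) = u n)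
    (hu₀ : ∀ σ : absoluteGaloisGroup F, galCBall σ (u 0 : CBall F) = u 0)
    (huN : ‖(((u 0 : (maxNilIdealC F).toIdeal) : CBall F) : CompletedAlgClosure F)‖ ^ N ≤ ‖(p : CompletedAlgClosure F)‖)
    {Tu : ℕ → (maxNilIdealC F).toIdeal} (hTu : ∀ n, AinfTop.mulPC F p E₀ (Tu (n + 1)) = Tu n)
    (hTuv : ∀ n, ‖(((Tu n : (maxNilIdealC F).toIdeal) : CBall F) : CompletedAlgClosure F) -
      (((u n : (maxNilIdealC F).toIdeal) : CBall F) : CompletedAlgClosure F)‖ ≤ ‖((D.rootC : integerC F) : CompletedAlgClosure F)‖)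
    {z : bmaxZero F p} (hz : algebraMap (Ainf (p := p) F) (bmaxZero F p)
        ((AinfTop.of F p).symm (((AinfTop.divisionLiftPt E₀ hθ Tu hTu).val : (AinfTop.nilTheta F p hθ).toIdeal) : AinfTop F p)) ^ N =
      (p : bmaxZero F p) * z) (σ : absoluteGaloisGroup F) :
    P₀ (AinfRamTop.kummerCocycleO W ψ hψ u hup hu₀ σ) =
        BdRPlusTop.gal F p σ (BdRPlusTop.of F p (bmaxPlusToBdR F p
          (PadicLogSeries.logSum ((algebraMap (Ainf (p := p) F) (bmaxZero F p)).comp zpToAinf) (GaloisContinuity.formalLogNum E₀ p) N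
          (algebraMap (Ainf (p := p) F) (bmaxZero F p)
            ((AinfTop.of F p).symm (((AinfTop.divisionLiftPt E₀ hθ Tu hTu).val : (AinfTop.nilTheta F p hθ).toIdeal) : AinfTop F p))) z))) -
          BdRPlusTop.of F p (bmaxPlusToBdR F p
            (PadicLogSeries.logSum ((algebraMap (Ainf (p := p) F) (bmaxZero F p)).comp zpToAinf) (GaloisContinuity.formalLogNum E₀ p) N
          (algebraMap (Ainf (p := p) F) (bmaxZero F p)
            ((AinfTop.of F p).symm (((AinfTop.divisionLiftPt E₀ hθ Tu hTu).val : (AinfTop.nilTheta F p hθ).toIdeal) : AinfTop F p))) z)) ∧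
      Q₀ (AinfRamTop.kummerCocycleO W ψ hψ u hup hu₀ σ) =
        BdRPlusTop.gal F p σ (BdRPlusTop.of F p (bmaxPlusToBdR F p (frobBmaxPlus F p
          (PadicLogSeries.logSum ((algebraMap (Ainf (p := p) F) (bmaxZero F p)).comp zpToAinf) (GaloisContinuity.formalLogNum E₀ p) N
          (algebraMap (Ainf (p := p) F) (bmaxZero F p)
            ((AinfTop.of F p).symm (((AinfTop.divisionLiftPt E₀ hθ Tu hTu).val : (AinfTop.nilTheta F p hθ).toIdeal) : AinfTop F p))) z)))) -
          BdRPlusTop.of F p (bmaxPlusToBdR F p (frobBmaxPlus F p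
            (PadicLogSeries.logSum ((algebraMap (Ainf (p := p) F) (bmaxZero F p)).comp zpToAinf) (GaloisContinuity.formalLogNum E₀ p) N
          (algebraMap (Ainf (p := p) F) (bmaxZero F p)
            ((AinfTop.of F p).symm (((AinfTop.divisionLiftPt E₀ hθ Tu hTu).val : (AinfTop.nilTheta F p hθ).toIdeal) : AinfTop F p))) z))) := by
  have hK := logSum_transport_kummerCocycleO D W E₀ hWE ψ hψ (hθ := hθ) hN hLT hup hu₀ huN hTu hTuv hz σ
  refine ⟨?_, ?_⟩
  · rw [hP₀, hK, map_sub, map_sub, BdRPlusTop.gal_of, galBdRPlus_bmaxPlusToBdR]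
  · rw [hQ₀, hK, map_sub, map_sub, map_sub, BdRPlusTop.gal_of, galBdRPlus_bmaxPlusToBdR, galBmaxPlus_frobBmaxPlus]

/-! ## §3 (K₂) for the transported resolution, `c_L`-free form -/

set_option maxHeartbeats 3200000 in
/-- ★★ **(K₂) for the transported pair.** With `P⁰, Q⁰` recognised through `hLT`, `hP₀`, `hQ₀`, `E₀ ⊗ ℚ_p`, `E₀ ⊗ 𝔽_p` elliptic, and ANY `Λ ∈ A_max`
with the Honda relation `φ²Λ − a_p·φΛ + p·Λ = 0` (e.g. `Λ_{Tu}`, `frobBmaxPlus_hondaTrace_logSum_divisionLiftPt_eq_zero` on the transported tower): for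
every `τ ∈ T_pŴ_D` and `k ≥ 1` there is `M` with **`IsTeichLog k (p^M·(Q⁰ τ·fΛ − P⁰ τ·f φΛ))`** — both `LT τ` (`frobBmaxPlus_hondaTrace_transport_eq_zero`)
and `Λ` solve Honda's equation, so their Legendre determinant lies in `(A_max)^{φ=p}`, whose image modulo `Fil^k` is `ℚ_p ⊗ X⁰_k`
(`isTeichLog_pow_mul_bmaxPlusToBdR_det_of_honda`); no `θ = 0` hypothesis is involved. [cite: Kato1993LNM1553, Ch. II §1.4]
[cite: FontaineAsterisque223III, Exp. III Th. 5.3.7] -/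
theorem isTeichLog_transported_resolution (hF : Function.Surjective (fontaineTheta (integerC F) p)) (hpv : valuation F p < 1)
    [(E₀.map (Int.castRingHom ℚ_[p])).IsElliptic] [(E₀.map (Int.castRingHom (ZMod p))).IsElliptic] {N : ℕ} (hN : D.e ≤ N)
    {LT : AinfTop.TatePtO F (W.map ψ) p →+ BmaxPlus F p} {P₀ Q₀ : AinfTop.TatePtO F (W.map ψ) p →+ BdRPlusTop F p}
    (hLT : ∀ (τ : AinfTop.TatePtO F (W.map ψ) p) (w : ℕ → (maxNilIdealC F).toIdeal) (hw : ∀ n, AinfTop.mulPC F p E₀ (w (n + 1)) = w n)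
        (_ : ∀ n, ‖(((w n : (maxNilIdealC F).toIdeal) : CBall F) : CompletedAlgClosure F) -
      (((AinfTop.seqO (W.map ψ) τ n : (maxNilIdealC F).toIdeal) : CBall F) : CompletedAlgClosure F)‖ ≤ ‖((D.rootC : integerC F) : CompletedAlgClosure F)‖)
        (z : bmaxZero F p), algebraMap (Ainf (p := p) F) (bmaxZero F p)
        ((AinfTop.of F p).symm (((AinfTop.divisionLiftPt E₀ hθ w hw).val : (AinfTop.nilTheta F p hθ).toIdeal) : AinfTop F p)) ^ N =
      (p : bmaxZero F p) * z →
        LT τ = PadicLogSeries.logSum ((algebraMap (Ainf (p := p) F) (bmaxZero F p)).comp zpToAinf) (GaloisContinuity.formalLogNum E₀ p) N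
          (algebraMap (Ainf (p := p) F) (bmaxZero F p)
            ((AinfTop.of F p).symm (((AinfTop.divisionLiftPt E₀ hθ w hw).val : (AinfTop.nilTheta F p hθ).toIdeal) : AinfTop F p))) z)
    (hP₀ : ∀ τ, P₀ τ = BdRPlusTop.of F p (bmaxPlusToBdR F p (LT τ)))
    (hQ₀ : ∀ τ, Q₀ τ = BdRPlusTop.of F p (bmaxPlusToBdR F p (frobBmaxPlus F p (LT τ))))
    {Λ : BmaxPlus F p}
    (hΛ : frobBmaxPlus F p (frobBmaxPlus F p Λ) -
        AdicCompletion.of (Ideal.span {(p : bmaxZero F p)}) (bmaxZero F p)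
          (((algebraMap (Ainf (p := p) F) (bmaxZero F p)).comp zpToAinf)
            ((HasseManin.tr (E₀.map (Int.castRingHom (ZMod p))) : ℤ) : ℤ_[p])) * frobBmaxPlus F p Λ +
        AdicCompletion.of (Ideal.span {(p : bmaxZero F p)}) (bmaxZero F p) (p : bmaxZero F p) * Λ = 0)
    (τ : AinfTop.TatePtO F (W.map ψ) p) {w : ℕ → (maxNilIdealC F).toIdeal} (hw : ∀ n, AinfTop.mulPC F p E₀ (w (n + 1)) = w n)
    (hwv : ∀ n, ‖(((w n : (maxNilIdealC F).toIdeal) : CBall F) : CompletedAlgClosure F) -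
      (((AinfTop.seqO (W.map ψ) τ n : (maxNilIdealC F).toIdeal) : CBall F) : CompletedAlgClosure F)‖ ≤ ‖((D.rootC : integerC F) : CompletedAlgClosure F)‖) {k : ℕ} (hk : 1 ≤ k) :
    ∃ M : ℕ, IsTeichLog k ((BdRPlusTop.of F p).symm ((p : BdRPlusTop F p) ^ M *
      (Q₀ τ * BdRPlusTop.of F p (bmaxPlusToBdR F p Λ) - P₀ τ * BdRPlusTop.of F p (bmaxPlusToBdR F p (frobBmaxPlus F p Λ))))) := by
  have hofp : AdicCompletion.of (Ideal.span {(p : bmaxZero F p)}) (bmaxZero F p) (p : bmaxZero F p) = (p : BmaxPlus F p) :=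
    map_natCast (algebraMap (bmaxZero F p) (BmaxPlus F p)) p
  have hΛ' := frobBmaxPlus_hondaTrace_transport_eq_zero D W E₀ ψ (hθ := hθ) hN hLT τ hw hwv
  rw [hofp] at hΛ hΛ'
  obtain ⟨M, hM⟩ := isTeichLog_pow_mul_bmaxPlusToBdR_det_of_honda hF hpv hk hΛ hΛ'
  refine ⟨M, ?_⟩
  rw [hQ₀, hP₀]
  have e : (BdRPlusTop.of F p).symm ((p : BdRPlusTop F p) ^ M *
      (BdRPlusTop.of F p (bmaxPlusToBdR F p (frobBmaxPlus F p (LT τ))) * BdRPlusTop.of F p (bmaxPlusToBdR F p Λ) -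
        BdRPlusTop.of F p (bmaxPlusToBdR F p (LT τ)) * BdRPlusTop.of F p (bmaxPlusToBdR F p (frobBmaxPlus F p Λ)))) =
      (p : BDeRhamPlus (integerC F) p) ^ M *
        (bmaxPlusToBdR F p Λ * bmaxPlusToBdR F p (frobBmaxPlus F p (LT τ)) -
          bmaxPlusToBdR F p (frobBmaxPlus F p Λ) * bmaxPlusToBdR F p (LT τ)) := by
    simp only [map_mul, map_sub, map_pow, map_natCast, RingEquiv.symm_apply_apply]
    ring
  rw [e]
  exact hM

/-! ## §4 `Γ_F`-invariant recombinations: the Hodge pair `Pω″ = A·P⁰ + B·Q⁰`, `Pη″ = C·P⁰` -/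

/-- ★ **Recombination with `Γ_F`-invariant scalars.** Let `P⁰, Q⁰ : T_pŴ_D →+ B_dR⁺` be `ℤ_p`-linear and `Γ_F`-equivariant, and `A, B, C ∈ B_dR⁺` be
`Γ_F`-INVARIANT and commute with the `ℤ_p`-scalars `ι(c)` (automatic in the commutative ring `B_dR⁺`; e.g. `A, B, C` images of elements of `F`).
Then there are additive `Pω″, Pη″ : T_pŴ_D →+ B_dR⁺` with **`Pω″ τ = A·P⁰ τ + B·Q⁰ τ`, `Pη″ τ = C·P⁰ τ`**, again `ℤ_p`-linear and `Γ_F`-equivariant;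
along any `κ` with integrating pair `(b⁰_ω, b⁰_η)` for `(P⁰, Q⁰)` they have the integrating pair **`b″_ω = A·b⁰_ω + B·b⁰_η`, `b″_η = C·b⁰_ω`**, and
their Legendre resolution is **`Pη″ τ·b″_ω − Pω″ τ·b″_η = −(B·C)·(Q⁰ τ·b⁰_ω − P⁰ τ·b⁰_η)`**. (For the cells: `A, B` from the transported Hodge line,
`C = B⁻¹`, so the resolution is `−x⁰` and (K₂) transfers by `IsTeichLog.neg`.) [cite: Kato1993LNM1553, Ch. II §1.4] [cite: Colmez1992PeriodesAbeliennes, §2] -/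
theorem exists_recombined_periodHoms {T : Type*} [AddCommGroup T] [Module ℤ_[p] T] [MulAction (absoluteGaloisGroup F) T]
    {P₀ Q₀ : T →+ BdRPlusTop F p}
    (hP₀Z : ∀ (c : ℤ_[p]) (τ : T), P₀ (c • τ) = BdRPlusTop.of F p (qpToBdR (c : ℚ_[p])) * P₀ τ)
    (hQ₀Z : ∀ (c : ℤ_[p]) (τ : T), Q₀ (c • τ) = BdRPlusTop.of F p (qpToBdR (c : ℚ_[p])) * Q₀ τ)
    (hP₀g : ∀ (σ : absoluteGaloisGroup F) (τ : T), BdRPlusTop.gal F p σ (P₀ τ) = P₀ (σ • τ))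
    (hQ₀g : ∀ (σ : absoluteGaloisGroup F) (τ : T), BdRPlusTop.gal F p σ (Q₀ τ) = Q₀ (σ • τ))
    (A B C : BdRPlusTop F p) (hA : ∀ σ : absoluteGaloisGroup F, BdRPlusTop.gal F p σ A = A)
    (hB : ∀ σ : absoluteGaloisGroup F, BdRPlusTop.gal F p σ B = B) (hC : ∀ σ : absoluteGaloisGroup F, BdRPlusTop.gal F p σ C = C) :
    ∃ Pω Pη : T →+ BdRPlusTop F p,
      (∀ τ, Pω τ = A * P₀ τ + B * Q₀ τ) ∧ (∀ τ, Pη τ = C * P₀ τ) ∧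
      (∀ (c : ℤ_[p]) (τ : T), Pω (c • τ) = BdRPlusTop.of F p (qpToBdR (c : ℚ_[p])) * Pω τ) ∧
      (∀ (c : ℤ_[p]) (τ : T), Pη (c • τ) = BdRPlusTop.of F p (qpToBdR (c : ℚ_[p])) * Pη τ) ∧
      (∀ (σ : absoluteGaloisGroup F) (τ : T), BdRPlusTop.gal F p σ (Pω τ) = Pω (σ • τ)) ∧
      (∀ (σ : absoluteGaloisGroup F) (τ : T), BdRPlusTop.gal F p σ (Pη τ) = Pη (σ • τ)) ∧
      (∀ (κ : absoluteGaloisGroup F → T) (bω bη : BdRPlusTop F p),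
        (∀ σ, P₀ (κ σ) = BdRPlusTop.gal F p σ bω - bω) → (∀ σ, Q₀ (κ σ) = BdRPlusTop.gal F p σ bη - bη) →
        (∀ σ, Pω (κ σ) = BdRPlusTop.gal F p σ (A * bω + B * bη) - (A * bω + B * bη)) ∧
        (∀ σ, Pη (κ σ) = BdRPlusTop.gal F p σ (C * bω) - C * bω) ∧
        (∀ τ, Pη τ * (A * bω + B * bη) - Pω τ * (C * bω) = -(B * C) * (Q₀ τ * bω - P₀ τ * bη))) := by
  refine ⟨(AddMonoidHom.mulLeft A).comp P₀ + (AddMonoidHom.mulLeft B).comp Q₀, (AddMonoidHom.mulLeft C).comp P₀,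
    fun τ => rfl, fun τ => rfl, ?_, ?_, ?_, ?_, ?_⟩
  · intro c τ
    change A * P₀ (c • τ) + B * Q₀ (c • τ) = _ * (A * P₀ τ + B * Q₀ τ)
    rw [hP₀Z, hQ₀Z]; ring
  · intro c τ
    change C * P₀ (c • τ) = _ * (C * P₀ τ)
    rw [hP₀Z]; ring
  · intro σ τ
    change BdRPlusTop.gal F p σ (A * P₀ τ + B * Q₀ τ) = A * P₀ (σ • τ) + B * Q₀ (σ • τ)
    rw [map_add, map_mul, map_mul, hA, hB, hP₀g, hQ₀g]
  · intro σ τ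
    change BdRPlusTop.gal F p σ (C * P₀ τ) = C * P₀ (σ • τ)
    rw [map_mul, hC, hP₀g]
  · intro κ bω bη hbω hbη
    refine ⟨fun σ => ?_, fun σ => ?_, fun τ => ?_⟩
    · change A * P₀ (κ σ) + B * Q₀ (κ σ) = _
      rw [hbω, hbη, map_add, map_mul, map_mul, hA, hB]; ring
    · change C * P₀ (κ σ) = _
      rw [hbω, map_mul, hC]; ring
    · change C * P₀ τ * (A * bω + B * bη) - (A * P₀ τ + B * Q₀ τ) * (C * bω) = _
      ring

end Literature.NumberTheory.PAdicHodge
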